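import Summits.HodgeConjecture.HodgeConjecture.Theorems.MarkmanPartnerTransportPicardThreeK3SquaresRMTypeOpenSingleEigenvalue
import Summits.HodgeConjecture.HodgeConjecture.Theorems.BoundaryReadoutPullbackAlgebraic
import Literature.AlgebraicGeometry.HodgeTheory.SmoothBlowupHodgeConjecture
import Literature.AlgebraicGeometry.HilbertScheme.HilbertSquareBlowupDiagonal
import Literature.AlgebraicGeometry.Surfaces.K3RealMultiplicationZeta11OpenFamily
import HarnessLib

/-!
# Route MarkmanPartnerTransport · crux `PicardThreeK3Squares` (stmt-HodgeConjecture-19652) —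
# HC⁴(S ⊗ S) BY NAME for every K3 surface of the ζ₁₁ real-multiplication type (cell (3,5))

Cell hodge-nonav, crux #4 (HC⁴(S ⊗ S); open core: real multiplication), target «VGS11-OPEN» of the
route owner (p1 g39, 2026-08-28): plug the van Geemen–Schütt ζ₁₁ family (Forum Math. Sigma 13 (2025)
e2, Thm. 1.1 (11), §4.8, §5.8), located on the period domain by Oguiso–Zhang (PAMQ 7 (2011),
Thm. 1.5), typed as the ∃-form open-set fact
`VanGeemenSchuett2025_OguisoZhang2011_zeta11_cycleOnOpenPeriodSet` (`Literature/…/K3RealMultiplicationZeta11OpenFamily`),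
into (T‴) `RMTypeOrbit.hodgeConjectureFor_square_of_exists_on_open_at_of_isK3Surface` (prover seat
hodge-nonav-19652-p1 gen 10). Prover seat hodge-nonav-19652-p1 gen 11; `--supports
stmt-HodgeConjecture-19652`, helper. CONDITIONAL on the two named facts
`Buskin2019_hodgeIsometry_algebraic` and `VanGeemenSchuett2025_OguisoZhang2011_zeta11_cycleOnOpenPeriodSet`
ONLY; credits nothing; nothing here says HC is proved.

* `k3Form_pow_pow_of_isometry` — powers of a `k3Form`-isometry are isometries.
* `selfAdjoint_of_zeta11Model` — the model endomorphism `θ_ℂ = (g + g¹⁰) - 2π_U` of an order-`11`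
  isometry `g` (`π_U y = (y.u₂)u₁ + (y.u₁)u₂`) is `k3Form`-self-adjoint (the adjoint of `g` is
  `g⁻¹ = g¹⁰`; `π_U` is symmetric).
* `two_mul_cos_two_pi_div_eleven_pos` — `e₀ = 2cos(2π/11) > 0`.
* **`hodgeConjectureFor_square_of_zeta11Type`** — for every datum `(g, u₁, u₂, y₀, θ)` of the fact
  (an integral isometry `g` of `Λ` of order `11` with invariant plane `ℤu₁ ⊕ ℤu₂ ≅ U` and a period
  point in its `ζ₁₁`-eigenspace; `θ_ℂ = (g + g¹⁰) - 2π_U`) and EVERY projective K3 surface `S` marked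
  by `(η, p, x)` carrying an endomorphism `t` of `H²(S(ℂ); ℂ)` (rational, type-preserving, killing
  `N¹`, image `⊥ N¹`, `P(t) = 0` on `T` for a separable `P` with `P(0) ≠ 0`, generating
  `End_Hdg T(S)`) that is conjugate by a RATIONAL ISOMETRY `σ` of `Λ_ℚ` to `θ_ℂ`
  (`σ η t = θ_ℂ σ η`): `HodgeConjectureFor 4 (S ⊗ S)`. In words: HC⁴ of the square of every K3
  surface whose rational real-multiplication type is that of a member of the maximal ζ₁₁ family —
  by `RMTypeOrbit.exists_isogenous_markedK3_mem_of_isOpen`, exactly the K3 surfaces RM-isogenous to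
  a member; the members themselves are the case `σ ∈ O(Λ)`.
* `hodgeConjectureFor_hilbertSquare_of_zeta11Type` — the same for every Hilbert square `S^{[2]}` of such
  an `S` (blow up the diagonal of `S × S`, descend along the surjection `B_Δ(S × S) → S^{[2]}`:
  `hodgeConjectureFor_of_tower_surjective_le_five` with `fulton1998_map_mem_algebraicClasses_holds`;
  + `Beauville1983_hilbertSquare_blowupDiagonal_surjection`). The `X`-side partner form (cell (3,5) of
  crux #5) is in the companion file `…LowPicardZeta11Partner` (it needs the route's `PartnerTransport`).

No definition, no sorry.

References: van Geemen–Schütt, Forum Math. Sigma 13 (2025) e2, Thm. 1.1 (11), Prop. 4.6, §4.8,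
§5.8; Oguiso–Zhang, Pure Appl. Math. Q. 7 (2011) 1657–1673, Thm. 1.5, Prop. 2.3; Buskin, J. reine
angew. Math. 755 (2019), Thm. 1.1; Huybrechts, *Lectures on K3 Surfaces*, Ch. 6 Prop. 1.5, Ch. 7
Thm. 5.3, Ch. 15 Cor. 2.3.
-/

set_option linter.dupNamespace false

noncomputable section

namespace Summit.HodgeConjecture.HodgeConjecture.Theorems.MarkmanPartnerTransport.RMTypeOrbit

open CategoryTheory MonoidalCategory Polynomial
open Literature.AlgebraicGeometry Literature.AlgebraicGeometry.Motives Literature.AlgebraicGeometry.HodgeTheory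
open Literature.AlgebraicGeometry.Surfaces Literature.LinearAlgebra.QuadraticForm
open Literature.AlgebraicGeometry.Hyperkaehler Literature.AlgebraicGeometry.HilbertScheme
open Literature.AlgebraicTopology.SingularHomology
open Summit.HodgeConjecture.HodgeConjecture.Theorems.NikulinTwinTransport
open Summit.HodgeConjecture.HodgeConjecture.Theorems.MarkmanPartnerTransport.IsogenyInvariance
open Summit.HodgeConjecture.HodgeConjecture.Theorems.MarkmanPartnerTransport.RMTypeDescent

/-- `MarkedK3[S, η, p, x]`: VERBATIM the `let MarkedK3 := …` binder of the route declaration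
`PicardThreeK3Squares` (as in `…RMTypeDescent`). Local notation only. -/
local notation3 (prettyPrint := false) "MarkedK3[" S ", " η ", " p ", " x "]" =>
  (p ≠ 0 ∧ (IsIntegralClass p ∧
    (∀ q : complexBetti S (2 * 2), IsIntegralClass q → ∃ n : ℤ, q = n • p) ∧
    (∀ c : complexBetti S (2 * 1), IsIntegralClass c ↔ ∃ v : K3Index → ℤ, η c = fun i => (v i : ℂ)) ∧
    (∀ a b : complexBetti S (2 * 1),
      cupProduct (rfl : 2 * 1 + 2 * 1 = 2 * 2) a b = k3Form (η a) (η b) • p) ∧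
    IsOfHodgeType 2 S (2 * 1) 2 0 (LinearEquiv.symm η x) ∧
    (∀ τ : complexBetti S (2 * 1), IsOfHodgeType 2 S (2 * 1) 2 0 τ →
      ∃ t : ℂ, τ = t • LinearEquiv.symm η x)) ∧
    (k3Form x x = 0 ∧ 0 < (k3Form (star x) x).re ∧
      ∃ u : K3Index → ℤ, k3Form (fun i => (u i : ℂ)) x = 0 ∧ 0 < ∑ i, ∑ j, u i * k3Gram i j * u j))

/-- `Zeta11Model[g, u₁, u₂, y₀, θ]`: VERBATIM the antecedents of the named fact
`VanGeemenSchuett2025_OguisoZhang2011_zeta11_cycleOnOpenPeriodSet` — `g` is an integral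
`k3Form`-isometry of `Λ_ℂ` of order `11` with invariant lattice the hyperbolic plane `ℤu₁ ⊕ ℤu₂ ≅ U`,
`y₀` is a period point in its `ζ₁₁ = e^{2πi/11}`-eigenspace, and `θ ∈ M₂₂(ℚ)` is the model
real-multiplication endomorphism: `θ_ℂ = (g + g¹⁰) - 2π_U`. Local notation only. -/
local notation3 (prettyPrint := false) "Zeta11Model[" g ", " u₁ ", " u₂ ", " y₀ ", " θ "]" =>
  ((∀ a b : K3Index → ℂ, k3Form (g a) (g b) = k3Form a b) ∧
    (∀ v : K3Index → ℤ, ∃ w : K3Index → ℤ,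
      g (fun i => ((v i : ℤ) : ℂ)) = fun i => ((w i : ℤ) : ℂ)) ∧
    g ^ 11 = 1 ∧
    g (fun i => ((u₁ i : ℤ) : ℂ)) = (fun i => ((u₁ i : ℤ) : ℂ)) ∧
    g (fun i => ((u₂ i : ℤ) : ℂ)) = (fun i => ((u₂ i : ℤ) : ℂ)) ∧
    k3Form (fun i => ((u₁ i : ℤ) : ℂ)) (fun i => ((u₁ i : ℤ) : ℂ)) = 0 ∧
    k3Form (fun i => ((u₂ i : ℤ) : ℂ)) (fun i => ((u₂ i : ℤ) : ℂ)) = 0 ∧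
    k3Form (fun i => ((u₁ i : ℤ) : ℂ)) (fun i => ((u₂ i : ℤ) : ℂ)) = 1 ∧
    (∀ v : K3Index → ℤ, g (fun i => ((v i : ℤ) : ℂ)) = (fun i => ((v i : ℤ) : ℂ)) →
      ∃ m n : ℤ, v = m • u₁ + n • u₂) ∧
    k3Form y₀ y₀ = 0 ∧ 0 < (k3Form (star y₀) y₀).re ∧
    g y₀ = Complex.exp (2 * Real.pi * Complex.I / 11) • y₀ ∧
    (∀ y : K3Index → ℂ, thetaC θ y =
      g y + (g ^ 10) y - (2 * k3Form y (fun i => ((u₂ i : ℤ) : ℂ))) • (fun i => ((u₁ i : ℤ) : ℂ))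
        - (2 * k3Form y (fun i => ((u₁ i : ℤ) : ℂ))) • (fun i => ((u₂ i : ℤ) : ℂ))))

variable {S : SchemeOver ℂ}

/-- Powers of a `k3Form`-isometry of `Λ_ℂ` are `k3Form`-isometries. [folklore] -/
theorem k3Form_pow_pow_of_isometry {g : Module.End ℂ (K3Index → ℂ)}
    (hg : ∀ a b : K3Index → ℂ, k3Form (g a) (g b) = k3Form a b) (k : ℕ) (a b : K3Index → ℂ) :
    k3Form ((g ^ k) a) ((g ^ k) b) = k3Form a b := by
  induction k with
  | zero => simp
  | succ k ih => rw [pow_succ', Module.End.mul_apply, Module.End.mul_apply, hg, ih]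

/-- **The ζ₁₁ model endomorphism is self-adjoint.** If `g` is a `k3Form`-isometry of `Λ_ℂ` with
`g¹¹ = 1` and `θ_ℂ = (g + g¹⁰) - 2π_U` with `π_U y = (y.u₂)u₁ + (y.u₁)u₂`, then
`(θ_ℂ a . b) = (a . θ_ℂ b)`: the adjoint of `g` is `g⁻¹ = g¹⁰` and `π_U` is symmetric. This is the
self-adjointness antecedent of the RM-type descent theorems for the model of `σ₀^* + (σ₀^*)⁻¹`.
[cite: GeemenSchutt2023, §2.1 (adjoint property) and §4.8] -/
theorem selfAdjoint_of_zeta11Model {g : Module.End ℂ (K3Index → ℂ)} {u₁ u₂ : K3Index → ℂ}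
    {θ : Matrix K3Index K3Index ℚ}
    (hg : ∀ a b : K3Index → ℂ, k3Form (g a) (g b) = k3Form a b) (hg11 : g ^ 11 = 1)
    (hθ : ∀ y : K3Index → ℂ, thetaC θ y =
      g y + (g ^ 10) y - (2 * k3Form y u₂) • u₁ - (2 * k3Form y u₁) • u₂) (a b : K3Index → ℂ) :
    k3Form (thetaC θ a) b = k3Form a (thetaC θ b) := by
  have h11a : ∀ c : K3Index → ℂ, g ((g ^ 10) c) = c := fun c => by
    rw [← Module.End.mul_apply, ← pow_succ', hg11, Module.End.one_apply]
  have h11b : ∀ c : K3Index → ℂ, (g ^ 10) (g c) = c := fun c => by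
    rw [← Module.End.mul_apply, ← pow_succ, hg11, Module.End.one_apply]
  have h1 : k3Form (g a) b = k3Form a ((g ^ 10) b) := by
    conv_lhs => rw [← h11a b]
    rw [hg]
  have h2 : k3Form ((g ^ 10) a) b = k3Form a (g b) := by
    conv_lhs => rw [← h11b b]
    rw [k3Form_pow_pow_of_isometry hg]
  rw [hθ a, hθ b]
  simp only [k3Form_sub_left, k3Form_add_left, k3Form_smul_left]
  rw [k3Form_comm a (g b + (g ^ 10) b - (2 * k3Form b u₂) • u₁ - (2 * k3Form b u₁) • u₂)]
  simp only [k3Form_sub_left, k3Form_add_left, k3Form_smul_left]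
  rw [k3Form_comm (g b) a, k3Form_comm ((g ^ 10) b) a, ← h1, ← h2, k3Form_comm u₁ b, k3Form_comm u₂ b,
    k3Form_comm u₁ a, k3Form_comm u₂ a]
  ring

/-- `2cos(2π/11) > 0` (`0 < 2π/11 < π/2`). [folklore] -/
theorem two_mul_cos_two_pi_div_eleven_pos : 0 < 2 * Real.cos (2 * Real.pi / 11) := by
  have h : 0 < Real.cos (2 * Real.pi / 11) := by
    apply Real.cos_pos_of_mem_Ioo
    constructor <;> nlinarith [Real.pi_pos]
  linarith

/-- **HC⁴(S ⊗ S) BY NAME for every K3 surface of the ζ₁₁ real-multiplication type.** Let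
`(g, u₁, u₂, y₀, θ)` be a datum of the named fact (an integral isometry `g` of the K3 lattice of order
`11` with invariant plane `ℤu₁ ⊕ ℤu₂ ≅ U`, a period point `y₀` with `g y₀ = ζ₁₁ y₀`, and the model
endomorphism `θ`, `θ_ℂ = (g + g¹⁰) - 2π_U` — the cohomological action of `σ₀^* + (σ₀^*)⁻¹` for the
order-`11` automorphism `σ₀` of a member `y² = x³ + bx + (t¹¹ + c)` of the van Geemen–Schütt family,
Oguiso–Zhang Thm. 1.5). Then EVERY projective K3 surface `S`, marked by `(η, p, x)` and carrying an
endomorphism `t` of `H²(S(ℂ); ℂ)` — rational, Hodge-type preserving, killing `N¹H²`, with image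
cup-orthogonal to `N¹H²`, annihilated on `T(S)` by a separable `P ∈ ℚ[X]` with `P(0) ≠ 0`, and
generating `End_Hdg T(S)` — which is conjugate to `θ_ℂ` by a RATIONAL ISOMETRY `σ` of `Λ_ℚ`
(`σ(η(t c)) = θ_ℂ(σ(η c))`), satisfies `HodgeConjectureFor 4 (S ⊗ S)`. Proof: `θ` is self-adjoint
(`selfAdjoint_of_zeta11Model`), `e₀ = 2cos(2π/11) ≠ 0`, the fact supplies an open `U ∋ y₁ ∈ D_{θ,e₀}`
with `CycleEx[θ, e₀, U]`, and (T‴) `hodgeConjectureFor_square_of_exists_on_open_at_of_isK3Surface`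
(rational orbit density + Buskin transport) concludes. CONDITIONAL on
`Buskin2019_hodgeIsometry_algebraic` and `VanGeemenSchuett2025_OguisoZhang2011_zeta11_cycleOnOpenPeriodSet`
ONLY; credits nothing; HC is NOT proved here.
[cite: GeemenSchutt2023, Thm. 1.1 (11), Prop. 4.6, §4.8, §5.8]
[cite: OguisoZhang2011K3Order11, Thm. 1.5 (3) and Prop. 2.3] [cite: Buskin2019, Thm. 1.1]
[cite: Huybrechts2016K3, Ch. 6 Prop. 1.5, Ch. 7 Thm. 5.3, Ch. 15 Cor. 2.3] -/
theorem hodgeConjectureFor_square_of_zeta11Type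
    (hB : Buskin2019_hodgeIsometry_algebraic)
    (hV : VanGeemenSchuett2025_OguisoZhang2011_zeta11_cycleOnOpenPeriodSet)
    {g : Module.End ℂ (K3Index → ℂ)} {u₁ u₂ : K3Index → ℤ} {y₀ : K3Index → ℂ}
    {θ : Matrix K3Index K3Index ℚ} (hZ : Zeta11Model[g, u₁, u₂, y₀, θ])
    {S : SchemeOver ℂ} (hS : IsK3Surface S) {P : ℚ[X]} (hPsep : P.Separable) (hP0 : P.eval 0 ≠ 0)
    (η : complexBetti S (2 * 1) ≃ₗ[ℂ] (K3Index → ℂ)) (p : complexBetti S (2 * 2)) (x : K3Index → ℂ)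
    (hM : MarkedK3[S, η, p, x])
    (t : complexBetti S (2 * 1) →ₗ[ℂ] complexBetti S (2 * 1))
    (ht_rat : ∀ y, IsRationalClass y → IsRationalClass (t y))
    (ht_typ : ∀ (i j : ℕ) (y : complexBetti S (2 * 1)),
      IsOfHodgeType 2 S (2 * 1) i j y → IsOfHodgeType 2 S (2 * 1) i j (t y))
    (ht_N : ∀ d ∈ algebraicClasses S 1, t d = 0)
    (ht_perp : ∀ (y : complexBetti S (2 * 1)), ∀ d ∈ algebraicClasses S 1,
      cupProduct (rfl : 2 * 1 + 2 * 1 = 2 * 2) (t y) d = 0)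
    (hP : IsAnnihilatedOnTranscendentalBy S t P) (hgen : TranscendentalEndomorphismsGeneratedBy S t)
    (σ : Module.End ℂ (K3Index → ℂ)) (hσ : ∀ a b, k3Form (σ a) (σ b) = k3Form a b)
    (hσrat : ∀ v : K3Index → ℤ, ∃ w : K3Index → ℚ, σ (fun i => (v i : ℂ)) = fun i => (w i : ℂ))
    (hconj : ∀ c : complexBetti S (2 * 1), σ (η (t c)) = thetaC θ (σ (η c))) :
    HodgeConjectureFor 4 (S ⊗ S) := by
  obtain ⟨hg, hgint, hg11, hgu₁, hgu₂, hu₁₁, hu₂₂, hu₁₂, hfix, hy₀₀, hy₀p, hgy₀, hθ⟩ := hZ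
  have hθsa : ∀ a b : K3Index → ℂ, k3Form (thetaC θ a) b = k3Form a (thetaC θ b) :=
    selfAdjoint_of_zeta11Model hg hg11 hθ
  have he₀ : (2 * Real.cos (2 * Real.pi / 11)) ≠ 0 := two_mul_cos_two_pi_div_eleven_pos.ne'
  obtain ⟨U, hU, ⟨y₁, hy₁U, hy₁, h₁₁, h₁p⟩, hcyc⟩ :=
    hV g u₁ u₂ y₀ θ hg hgint hg11 hgu₁ hgu₂ hu₁₁ hu₂₂ hu₁₂ hfix hy₀₀ hy₀p hgy₀ hθ
  exact hodgeConjectureFor_square_of_exists_on_open_at_of_isK3Surface hB hθsa he₀ hU hy₁U hy₁ h₁₁ h₁p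
    hcyc hS hPsep hP0 η p x hM t ht_rat ht_typ ht_N ht_perp hP hgen σ hσ hσrat hconj

/-- **HC⁴ of every Hilbert square `S^{[2]}` of every K3 surface of the ζ₁₁ real-multiplication type** —
`hodgeConjectureFor_square_of_zeta11Type` followed by `HC⁴(S × S) ⇒ HC⁴(S^{[2]})`: `S^{[2]}` is the
surjective image of the smooth blow-up of `S × S` along the diagonal
(`Beauville1983_hilbertSquare_blowupDiagonal_surjection`), so `hodgeConjectureFor_of_tower_surjective_le_five`
(pull-back input discharged by `fulton1998_map_mem_algebraicClasses_holds`) applies. These Hilbert squares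
have `ρ(S^{[2]}) = ρ(S) + 1` (`= 3` for the van Geemen–Schütt members): the model examples of cell (3,5) of
crux #5 `LowPicardRealMultiplication`. CONDITIONAL on `Buskin2019_hodgeIsometry_algebraic`,
`VanGeemenSchuett2025_OguisoZhang2011_zeta11_cycleOnOpenPeriodSet` and
`Beauville1983_hilbertSquare_blowupDiagonal_surjection`; credits nothing; HC is NOT proved here.
[cite: GeemenSchutt2023, Thm. 1.1 (11), §4.8, §5.8] [cite: OguisoZhang2011K3Order11, Thm. 1.5 (3)]
[cite: Beauville1983, §6 (e)–(f), p. 766] [cite: Arapura2001HodgeCyclesModuli, Lemma 13 and Lemma 16]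
[cite: Buskin2019, Thm. 1.1] -/
theorem hodgeConjectureFor_hilbertSquare_of_zeta11Type
    (hB : Buskin2019_hodgeIsometry_algebraic)
    (hV : VanGeemenSchuett2025_OguisoZhang2011_zeta11_cycleOnOpenPeriodSet)
    (hBea : Beauville1983_hilbertSquare_blowupDiagonal_surjection)
    {g : Module.End ℂ (K3Index → ℂ)} {u₁ u₂ : K3Index → ℤ} {y₀ : K3Index → ℂ}
    {θ : Matrix K3Index K3Index ℚ} (hZ : Zeta11Model[g, u₁, u₂, y₀, θ])
    {S H : SchemeOver ℂ} (hS : IsK3Surface S) {Ξ : (S ⊗ H).left.IdealSheafData}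
    (hHilb : IsHilbertSchemeOfPoints 2 S H Ξ) (hH : IsSmoothProjective 4 H)
    {P : ℚ[X]} (hPsep : P.Separable) (hP0 : P.eval 0 ≠ 0)
    (η : complexBetti S (2 * 1) ≃ₗ[ℂ] (K3Index → ℂ)) (p : complexBetti S (2 * 2)) (x : K3Index → ℂ)
    (hM : MarkedK3[S, η, p, x])
    (t : complexBetti S (2 * 1) →ₗ[ℂ] complexBetti S (2 * 1))
    (ht_rat : ∀ y, IsRationalClass y → IsRationalClass (t y))
    (ht_typ : ∀ (i j : ℕ) (y : complexBetti S (2 * 1)),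
      IsOfHodgeType 2 S (2 * 1) i j y → IsOfHodgeType 2 S (2 * 1) i j (t y))
    (ht_N : ∀ d ∈ algebraicClasses S 1, t d = 0)
    (ht_perp : ∀ (y : complexBetti S (2 * 1)), ∀ d ∈ algebraicClasses S 1,
      cupProduct (rfl : 2 * 1 + 2 * 1 = 2 * 2) (t y) d = 0)
    (hP : IsAnnihilatedOnTranscendentalBy S t P) (hgen : TranscendentalEndomorphismsGeneratedBy S t)
    (σ : Module.End ℂ (K3Index → ℂ)) (hσ : ∀ a b, k3Form (σ a) (σ b) = k3Form a b)
    (hσrat : ∀ v : K3Index → ℤ, ∃ w : K3Index → ℚ, σ (fun i => (v i : ℂ)) = fun i => (w i : ℂ))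
    (hconj : ∀ c : complexBetti S (2 * 1), σ (η (t c)) = thetaC θ (σ (η c))) :
    HodgeConjectureFor 4 H := by
  have hS2 : IsSmoothProjective 2 S := hS.isSmoothProjective
  obtain ⟨B, b, ρ, hBl, hρs⟩ := hBea S hS2 H Ξ hHilb
  haveI := hρs
  exact hodgeConjectureFor_of_tower_surjective_le_five fulton1998_map_mem_algebraicClasses_holds (n := 4)
    (by norm_num) (Relation.ReflTransGen.single (hBl.smoothBlowupStep (by norm_num))) hBl.top hH ρ
    (hodgeConjectureFor_square_of_zeta11Type hB hV hZ hS hPsep hP0 η p x hM t ht_rat ht_typ ht_N ht_perp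
      hP hgen σ hσ hσrat hconj)

end Summit.HodgeConjecture.HodgeConjecture.Theorems.MarkmanPartnerTransport.RMTypeOrbit

end
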